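import Summits.QuantumFields.YangMills.Theorems.BalabanUVNodesPortS1LocPowExpansion
import Literature.MathematicalPhysics.QuantumFieldTheory.Balaban1983to89.TreeLengthTorusGeometry

/-!
# NODE O port PT-A — THE (R-c) LEAF, WALK-SUM EDITION, PART B (the POLYMER BOUND; director-ym №548 GO): for pieces `T_i` with localization-domain supports `supp i` and operator bounds
# `‖T_i‖ ≤ c·e^{−δ·d(supp i)}`, the chain sums of PART A obey `Σ_{chains ↦ U} Π ‖T_{lⱼ}‖ ≤ cᵐ·e^{δ(m−1)}·e^{−(δ∕2)·d(U)}·Kᵐ·|U|` — [II] (2.27) for the union of a chain + the Dimock∕(1.26)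
# touching-sums as a displayed index hypothesis — hence `‖locPowPiece …  m U‖ ≤ N_U·|U|·(cK e^δ)ᵐ e^{−δ}·e^{−(δ∕2) d(U)}`: the POWER members of (63) in `B13.LogHalfBound` shape

Cell `ym-nodeO-ideate`, porter seat `ymgap-nodeO-port-PTA-1` (gen 7, lead of the line `pta-residueW` of 27930's skeleton v3.2); `--supports stmt-QuantumFields-27930` (helper).
[16] = [Balaban1985UV3] (63) p.272, (23) p.262; [II] = [Balaban1988RG2Cluster] (2.27) p.18, (1.26) p.8; [I] = [Balaban1987RG1] (1.7), (1.18) p.263; [Dimock2013] App. A Cor. 26.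

WHY.  PART A (✓p819488 `…LocPowExpansion`) wrote `Tr (Σ_i T_i)ᵐ = Σ_U locPowPiece supp T m U` with `‖locPowPiece … m U‖ ≤ N_U · Σ_{chains ↦ U} Π ‖T_{lⱼ}‖` (chains = m-tuples whose consecutive supports
meet, attached to the union `U` of their supports).  THIS FILE bounds the chain sum from two inputs: (i) the TREE-LENGTH OF A CHAIN — `d(U) + 2 ≤ Σⱼ (d(supp lⱼ) + 2)` for a chaining list with union
`U` (✓ `TreeLengthTorusGeometry.torusTreeLen_biUnion_add_two_le`, [II] (2.27) sharpened), so half of each factor's decay pays for `e^{−(δ∕2) d(U)}`; (ii) a DISPLAYED TOUCHING-SUM hypothesis on the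
index family, `∀ Y, Σ_{i : supp i ∩ Y ≠ ∅} v(i)·|supp i| ≤ K·|Y|` with `v(i) = e^{−(δ∕2) d(supp i)}` — at the record (`i` = the localization domains) this is ✓ `B12TreeDecay.ineq126_touches` ([II] (1.26)
∕ Dimock Cor. 26, constants `kappa₀`, `K₀`, torus instances ✓ `TreeLengthTorus.tdegreeLE ∕ tvolumeLeaf`) after absorbing `|supp i| ≤ 4·2^d (1 + d)` into the rate — the consumer's one-line
instantiation.  The other half of the decay counts the chains: anchored at a piece meeting `U`, each next piece meets the previous one — `A_m(Y) ≤ Kᵐ·|Y|` by induction on the length.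
* §1 list bookkeeping: `foldr_union_eq_biUnion_toFinset`, `sum_toFinset_le_sum_map` (dropping repeats under a non-negative summand), ★ `dj_union_add_two_le_sum` ((2.27) along a chaining list).
* §2 `prod_map_le_of_le` (monotone products of non-negative factors), ★ `prod_exp_decay_le` (`Π c e^{−δ dⱼ} ≤ cᵐ e^{δ(m−1)} e^{−(δ∕2) d(U)} Π e^{−(δ∕2) dⱼ}`).
* §3 the anchored chain sums `anchoredChainSum`, ★★ `anchoredChainSum_le` (`≤ Kᵐ·|Y|` under the touching-sum hypothesis), `chainSumTo_le_anchored`.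
* §4 ★★★ `chainSum_le` and ★★★ `norm_locPowPiece_le_decay` — the POWER member's piece of `U` in `LogHalfBound` shape.

HONEST FRAMING.  Finite combinatorics over the tree's torus tree-length ([folklore] + [II] (2.27) ✓ in tree); the touching-sum property of the index family is a DISPLAYED hypothesis (at the record =
✓ (1.26)); NOTHING of Bałaban's estimates asserted, ported or discharged; the letter (P1)–(P5), the leaves (P6) and the glue are NOT here; `stub_LZdet` ⊃ P0-ℂ and `stub_FE` OPEN; 27930 ⁸-Ax-LR4 OPEN ·
2∕4 stubs · no claim; NODE O 0∕1; COUNT 8∕28 · K 1∕4 UNMOVED; finite `𝕋⁴_{L^K}` at fixed ε — NOT continuum ∕ OS ∕ Clay; **the Yang–Mills mass gap is NOT proved by any of this.**  No `sorry`, no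
`instance`, no `notation`; one small `def` (`anchoredChainSum`); standard axioms.
-/

open scoped BigOperators Matrix.Norms.L2Operator
open Finset

namespace Summit.QuantumFields.YangMills.Theorems.BalabanUVNodesPortS1

open Literature.MathematicalPhysics.QuantumFieldTheory.Balaban1983to89
open Literature.MathematicalPhysics.QuantumFieldTheory.Balaban1983to89.TreeLengthTorus (TPt IsTDom TFaceConnected torusTreeLen torusTreeLen_nonneg)
open Literature.MathematicalPhysics.QuantumFieldTheory.Balaban1983to89.TreeLengthTorusGeometry (torusTreeLen_biUnion_add_two_le)

variable {d N : ℕ}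

/-! ## §1  The union of a list of supports; (2.27) along a chaining list -/

section Lists

variable {ι : Type*} (supp : ι → Finset (TPt d N))

/-- The folded union of the supports along a list is the `biUnion` of the list's finset of supports. [folklore] -/
theorem foldr_union_eq_biUnion_toFinset : ∀ l : List ι, (l.map supp).foldr (· ∪ ·) ∅ = ((l.map supp).toFinset).biUnion id
  | [] => by simp
  | i :: l => by
    rw [List.map_cons, List.foldr_cons, List.toFinset_cons, Finset.biUnion_insert, foldr_union_eq_biUnion_toFinset l]
    rfl

/-- Dropping repeats does not increase a sum of NON-NEGATIVE terms: `Σ_{Y ∈ (l.map f).toFinset} g Y ≤ ((l.map f).map g).sum`. [folklore] -/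
theorem sum_toFinset_le_sum_map {β : Type*} [DecidableEq β] (f : ι → β) (g : β → ℝ) (hg : ∀ b, 0 ≤ g b) :
    ∀ l : List ι, ∑ Y ∈ (l.map f).toFinset, g Y ≤ ((l.map f).map g).sum
  | [] => by simp
  | i :: l => by
    rw [List.map_cons, List.toFinset_cons, List.map_cons, List.sum_cons]
    calc ∑ Y ∈ insert (f i) (l.map f).toFinset, g Y ≤ g (f i) + ∑ Y ∈ (l.map f).toFinset, g Y := by
          by_cases h : f i ∈ (l.map f).toFinset
          · rw [Finset.insert_eq_of_mem h]; linarith [hg (f i)]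
          · rw [Finset.sum_insert h]
      _ ≤ g (f i) + ((l.map f).map g).sum := by linarith [sum_toFinset_le_sum_map f g hg l]

variable [NeZero N]

/-- ★ **(2.27) ALONG A CHAINING LIST**: if every support is a torus localization domain and consecutive supports meet, then for a non-empty list with union `U`:
`d(U) + 2 ≤ Σⱼ (d(supp lⱼ) + 2)` (`d` = `torusTreeLen`; the union is face-connected by PART A's `isTDom_union_of_isChain`). [cite: Balaban1988RG2Cluster, (2.27) p.18] -/
theorem dj_union_add_two_le_sum (hsupp : ∀ i, IsTDom (supp i)) (l : List ι) (hne : l ≠ [])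
    (hch : List.IsChain (fun i j => ¬ Disjoint (supp i) (supp j)) l) :
    torusTreeLen ((l.map supp).foldr (· ∪ ·) ∅) + 2 ≤ ((l.map supp).map fun Y => torusTreeLen Y + 2).sum := by
  have hU := isTDom_union_of_isChain supp hsupp l hne hch
  rw [foldr_union_eq_biUnion_toFinset] at hU ⊢
  have hD : ((l.map supp).toFinset).Nonempty := by
    obtain ⟨i, l', rfl⟩ := List.exists_cons_of_ne_nil hne
    exact ⟨supp i, List.mem_toFinset.2 (List.mem_cons_self)⟩
  have hmem : ∀ Y ∈ (l.map supp).toFinset, Y.Nonempty ∧ TFaceConnected Y := by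
    intro Y hY
    obtain ⟨i, _, rfl⟩ := List.mem_map.1 (List.mem_toFinset.1 hY)
    exact hsupp i
  refine (torusTreeLen_biUnion_add_two_le hD hmem hU.2).trans ?_
  exact sum_toFinset_le_sum_map supp (fun Y => torusTreeLen Y + 2) (fun Y => by linarith [torusTreeLen_nonneg Y]) l

end Lists

/-! ## §2  Splitting the decay of a chain: half pays for the union, half stays on the factors -/

section Decay

variable {ι : Type*}

/-- Products of lists are monotone under termwise comparison of non-negative factors. [folklore] -/
theorem prod_map_le_of_le (f g : ι → ℝ) (hf : ∀ i, 0 ≤ f i) (hfg : ∀ i, f i ≤ g i) :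
    ∀ l : List ι, (l.map f).prod ≤ (l.map g).prod
  | [] => by simp
  | i :: l => by
    rw [List.map_cons, List.prod_cons, List.map_cons, List.prod_cons]
    have hg0 : 0 ≤ (l.map g).prod := List.prod_nonneg fun x hx => by
      obtain ⟨j, _, rfl⟩ := List.mem_map.1 hx; exact (hf j).trans (hfg j)
    exact mul_le_mul (hfg i) (prod_map_le_of_le f g hf hfg l) (List.prod_nonneg fun x hx => by
      obtain ⟨j, _, rfl⟩ := List.mem_map.1 hx; exact hf j) ((hf i).trans (hfg i))

/-- `Π_j c·e^{−δ dⱼ} = cᵐ · e^{−δ Σ dⱼ}` along a list of length `m`. [folklore] -/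
theorem prod_map_const_mul_exp (c δ : ℝ) (dd : ι → ℝ) :
    ∀ l : List ι, (l.map fun i => c * Real.exp (-(δ * dd i))).prod = c ^ l.length * Real.exp (-(δ * (l.map dd).sum))
  | [] => by simp
  | i :: l => by
    rw [List.map_cons, List.prod_cons, prod_map_const_mul_exp c δ dd l, List.length_cons, List.map_cons, List.sum_cons, pow_succ]
    rw [show -(δ * (dd i + (l.map dd).sum)) = -(δ * dd i) + -(δ * (l.map dd).sum) by ring, Real.exp_add]
    ring

variable [NeZero N] (supp : ι → Finset (TPt d N))

/-- ★ **THE DECAY OF A CHAIN, SPLIT**: for a chaining non-empty list of domain supports with union `U` and `0 ≤ c`, `0 ≤ δ`: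
`Π_j c·e^{−δ d(supp lⱼ)} ≤ c^{m} · e^{δ(m−1)} · e^{−(δ∕2) d(U)} · Π_j e^{−(δ∕2) d(supp lⱼ)}` (half of the decay and (2.27) give the union's decay). [cite: Balaban1988RG2Cluster, (2.27) p.18; Balaban1985UV3, (23) p.262] -/
theorem prod_exp_decay_le (hsupp : ∀ i, IsTDom (supp i)) {c δ : ℝ} (hc : 0 ≤ c) (hδ : 0 ≤ δ) (l : List ι) (hne : l ≠ [])
    (hch : List.IsChain (fun i j => ¬ Disjoint (supp i) (supp j)) l) :
    (l.map fun i => c * Real.exp (-(δ * torusTreeLen (supp i)))).prod ≤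
      c ^ l.length * Real.exp (δ * (l.length - 1)) * Real.exp (-(δ / 2 * torusTreeLen ((l.map supp).foldr (· ∪ ·) ∅))) *
        (l.map fun i => Real.exp (-(δ / 2 * torusTreeLen (supp i)))).prod := by
  have h227 := dj_union_add_two_le_sum supp hsupp l hne hch
  set U := (l.map supp).foldr (· ∪ ·) ∅ with hUdef
  set S := (l.map fun i => torusTreeLen (supp i)).sum with hS
  have hsum2 : ((l.map supp).map fun Y => torusTreeLen Y + 2).sum = S + 2 * l.length := by
    rw [hS, List.map_map]
    clear h227 hne hch hUdef hS
    induction l with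
    | nil => simp
    | cons i l ih =>
      simp only [List.map_cons, List.sum_cons, Function.comp_apply, List.length_cons] at ih ⊢
      rw [ih]; push_cast; ring
  rw [hsum2] at h227
  -- exact forms of both products
  rw [prod_map_const_mul_exp c δ (fun i => torusTreeLen (supp i)) l]
  have hhalf : (l.map fun i => Real.exp (-(δ / 2 * torusTreeLen (supp i)))).prod = Real.exp (-(δ / 2 * S)) := by
    have h := prod_map_const_mul_exp 1 (δ / 2) (fun i => torusTreeLen (supp i)) l
    simp only [one_mul, one_pow] at h
    rw [h]
  rw [hhalf, ← hS]
  have hlen : (1 : ℝ) ≤ l.length := by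
    obtain ⟨i, l', rfl⟩ := List.exists_cons_of_ne_nil hne
    simp
  -- compare exponents: −δ S ≤ δ(m−1) − (δ/2) d(U) − (δ/2) S, i.e. (δ/2)(d(U) − S) ≤ δ(m − 1), from (2.27): d(U) + 2 ≤ S + 2m
  have hexp : Real.exp (-(δ * S)) ≤ Real.exp (δ * (l.length - 1)) * Real.exp (-(δ / 2 * torusTreeLen U)) * Real.exp (-(δ / 2 * S)) := by
    rw [← Real.exp_add, ← Real.exp_add]
    refine Real.exp_le_exp.2 ?_
    have hkey : torusTreeLen U ≤ S + 2 * (l.length : ℝ) - 2 := by linarith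
    nlinarith [mul_le_mul_of_nonneg_left hkey (by linarith : (0 : ℝ) ≤ δ / 2)]
  calc c ^ l.length * Real.exp (-(δ * S)) ≤ c ^ l.length * (Real.exp (δ * (l.length - 1)) * Real.exp (-(δ / 2 * torusTreeLen U)) * Real.exp (-(δ / 2 * S))) :=
        mul_le_mul_of_nonneg_left hexp (pow_nonneg hc _)
    _ = _ := by ring

end Decay

/-! ## §3  Counting the chains: anchored chain sums under the touching-sum hypothesis -/

section Anchored

variable {ι : Type} [Fintype ι] [DecidableEq ι] (supp : ι → Finset (TPt d N)) (v : ι → ℝ)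

omit supp v in
/-- Summing over `listsLen (m+1)` = summing over the head and over `listsLen m` (any additive commutative monoid; ✓ `sum_listsLen_succ` is the `ℂ` case). [folklore] -/
theorem sum_listsLen_succ' {β : Type*} [AddCommMonoid β] (m : ℕ) (f : List ι → β) :
    ∑ l ∈ listsLen (S := ι) (m + 1), f l = ∑ s : ι, ∑ l ∈ listsLen (S := ι) m, f (s :: l) := by
  show ∑ l ∈ Finset.univ.biUnion (fun s : ι => (listsLen m).image (List.cons s)), f l = _
  rw [sum_biUnion (fun s hs s' hs' h => pairwiseDisjoint_image_cons (listsLen m) (Set.mem_univ s) (Set.mem_univ s') h)]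
  refine sum_congr rfl fun s _ => ?_
  rw [sum_image fun l _ l' _ h => (List.cons.inj h).2]

/-- **The ANCHORED chain sum of length `m` at the cube set `Y`**: the sum over the lists of length `m` whose first support MEETS `Y` and whose consecutive supports meet, of the products of the
weights `v`. [cite: Balaban1988RG2Cluster, p.18 (after (2.27)); Dimock2013, App. A Cor. 26] -/
noncomputable def anchoredChainSum (m : ℕ) (Y : Finset (TPt d N)) : ℝ :=
  ∑ l ∈ (listsLen (S := ι) m).filter (fun l => (∀ i ∈ l.head?, (supp i ∩ Y).Nonempty) ∧ List.IsChain (fun i j => ((supp j) ∩ (supp i)).Nonempty) l),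
    (l.map v).prod

variable {supp v}

/-- The anchored chain sum of length `m + 1` recurses over the first piece: `A_{m+1}(Y) = Σ_{i : supp i ∩ Y ≠ ∅} v i · A_m(supp i)`. [folklore] -/
theorem anchoredChainSum_succ (m : ℕ) (Y : Finset (TPt d N)) :
    anchoredChainSum supp v (m + 1) Y = ∑ i ∈ univ.filter (fun i => (supp i ∩ Y).Nonempty), v i * anchoredChainSum supp v m (supp i) := by
  unfold anchoredChainSum
  rw [sum_filter, sum_listsLen_succ', sum_filter]
  refine sum_congr rfl fun i _ => ?_
  by_cases hi : (supp i ∩ Y).Nonempty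
  · rw [if_pos hi, mul_sum, sum_filter]
    refine sum_congr rfl fun l _ => ?_
    have hiff : ((∀ i' ∈ (i :: l).head?, (supp i' ∩ Y).Nonempty) ∧ List.IsChain (fun a b => (supp b ∩ supp a).Nonempty) (i :: l)) ↔
        ((∀ j ∈ l.head?, (supp j ∩ supp i).Nonempty) ∧ List.IsChain (fun a b => (supp b ∩ supp a).Nonempty) l) := by
      rw [List.isChain_cons]
      simp only [List.head?_cons, Option.mem_def, Option.some.injEq, forall_eq']
      exact ⟨fun h => h.2, fun h => ⟨hi, h⟩⟩
    rw [List.map_cons, List.prod_cons]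
    by_cases hc : (∀ j ∈ l.head?, (supp j ∩ supp i).Nonempty) ∧ List.IsChain (fun a b => (supp b ∩ supp a).Nonempty) l
    · rw [if_pos (hiff.2 hc), if_pos hc]
    · rw [if_neg (fun h => hc (hiff.1 h)), if_neg hc]
  · rw [if_neg hi]
    refine sum_eq_zero fun l _ => ?_
    rw [if_neg]
    rintro ⟨h, -⟩
    exact hi (h i (by simp))

/-- `A_0(Y) = 1` (the empty chain). [folklore] -/
theorem anchoredChainSum_zero (Y : Finset (TPt d N)) : anchoredChainSum supp v 0 Y = 1 := by
  unfold anchoredChainSum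
  rw [sum_filter, show listsLen (S := ι) 0 = {[]} from rfl, sum_singleton, if_pos]
  · simp
  · exact ⟨fun i hi => by simp at hi, List.isChain_nil⟩

/-- ★★ **THE ANCHORED CHAIN SUMS ARE GEOMETRIC**: under the TOUCHING-SUM hypothesis `∀ Y, Σ_{i : supp i ∩ Y ≠ ∅} v i · |supp i| ≤ K·|Y|` (at the record: [II] (1.26) ∕ Dimock Cor. 26,
✓ `B12TreeDecay.ineq126_touches`, with `|supp i|` absorbed into the rate) and `v ≥ 0`, `A_m(Y) ≤ Kᵐ·|Y|` for every non-empty `Y` and supports that are never empty.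
[cite: Balaban1988RG2Cluster, (1.26) p.8, p.18; Dimock2013, App. A Cor. 26] -/
theorem anchoredChainSum_le (hv : ∀ i, 0 ≤ v i) (hsupp : ∀ i, (supp i).Nonempty) {K : ℝ} (hK : 0 ≤ K)
    (hcount : ∀ Y : Finset (TPt d N), ∑ i ∈ univ.filter (fun i => (supp i ∩ Y).Nonempty), v i * (supp i).card ≤ K * Y.card) :
    ∀ (m : ℕ) (Y : Finset (TPt d N)), Y.Nonempty → anchoredChainSum supp v m Y ≤ K ^ m * Y.card
  | 0, Y, hY => by
    rw [anchoredChainSum_zero, pow_zero, one_mul]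
    exact_mod_cast Finset.card_pos.2 hY
  | m + 1, Y, _ => by
    rw [anchoredChainSum_succ]
    calc ∑ i ∈ univ.filter (fun i => (supp i ∩ Y).Nonempty), v i * anchoredChainSum supp v m (supp i)
        ≤ ∑ i ∈ univ.filter (fun i => (supp i ∩ Y).Nonempty), v i * (K ^ m * (supp i).card) :=
          sum_le_sum fun i _ => mul_le_mul_of_nonneg_left (anchoredChainSum_le hv hsupp hK hcount m (supp i) (hsupp i)) (hv i)
      _ = K ^ m * ∑ i ∈ univ.filter (fun i => (supp i ∩ Y).Nonempty), v i * (supp i).card := by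
          rw [mul_sum]; exact sum_congr rfl fun i _ => by ring
      _ ≤ K ^ m * (K * Y.card) := mul_le_mul_of_nonneg_left (hcount Y) (pow_nonneg hK m)
      _ = K ^ (m + 1) * Y.card := by ring

/-- **CHAINS WITH UNION `U` ARE ANCHORED AT `U`**: the chain sum of PART A's bound (lists chaining under `¬ Disjoint`, union exactly `U`) is at most the anchored chain sum at `U` — every support lies
inside the union, so the first one meets `U` (supports non-empty). [folklore] -/
theorem chainSumTo_le_anchored (hv : ∀ i, 0 ≤ v i) (hsupp : ∀ i, (supp i).Nonempty) (m : ℕ) (U : Finset (TPt d N)) :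
    ∑ l ∈ (listsLen (S := ι) m).filter (fun l => List.IsChain (fun i j => ¬ Disjoint (supp i) (supp j)) l ∧ (l.map supp).foldr (· ∪ ·) ∅ = U), (l.map v).prod
      ≤ anchoredChainSum supp v m U := by
  unfold anchoredChainSum
  refine sum_le_sum_of_subset_of_nonneg (fun l hl => ?_) (fun l _ _ => List.prod_nonneg fun x hx => by
    obtain ⟨j, _, rfl⟩ := List.mem_map.1 hx; exact hv j)
  rw [mem_filter] at hl ⊢
  obtain ⟨hl, hch, hU⟩ := hl
  refine ⟨hl, ?_, ?_⟩
  · intro i hi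
    -- `i` is the head: its support lies in the union `U`
    obtain ⟨l', rfl⟩ : ∃ l', l = i :: l' := by
      cases l with
      | nil => simp at hi
      | cons a l' => simp only [List.head?_cons, Option.mem_def, Option.some.injEq] at hi; exact ⟨l', by rw [hi]⟩
    have hsub : supp i ⊆ U := by
      rw [← hU, List.map_cons, List.foldr_cons]; exact subset_union_left
    obtain ⟨x, hx⟩ := hsupp i
    exact ⟨x, mem_inter.2 ⟨hx, hsub hx⟩⟩
  · exact List.IsChain.imp (fun a b h => by rwa [Finset.not_disjoint_iff_nonempty_inter, inter_comm] at h) hch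

end Anchored

/-! ## §4  ★★★ The polymer bound on the chain sums and on the power member's pieces -/

section Polymer

variable [NeZero N] {S : Type} [Fintype S] [DecidableEq S] {ι : Type} [Fintype ι] [DecidableEq ι]
  {supp : ι → Finset (TPt d N)} {T : ι → Matrix S S ℂ} {cube : S → TPt d N}

/-- ★★★ **THE CHAIN SUM TO `U` IS EXPONENTIALLY SMALL IN `d(U)`**: supports are localization domains, `‖T_i‖ ≤ c·e^{−δ d(supp i)}`, and the index family satisfies the touching-sum hypothesis with weight
`e^{−(δ∕2) d(supp i)}·|supp i|`; then for `m ≥ 1`: `Σ_{chains ↦ U} Π ‖T_{lⱼ}‖ ≤ cᵐ e^{δ(m−1)} e^{−(δ∕2) d(U)} · Kᵐ · |U|`.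
[cite: Balaban1985UV3, (23) p.262, p.272; Balaban1988RG2Cluster, (2.27) p.18, (1.26) p.8] -/
theorem chainSum_le (hsupp : ∀ i, IsTDom (supp i)) {c δ K : ℝ} (hc : 0 ≤ c) (hδ : 0 ≤ δ) (hK : 0 ≤ K)
    (hT : ∀ i, ‖T i‖ ≤ c * Real.exp (-(δ * torusTreeLen (supp i))))
    (hcount : ∀ Y : Finset (TPt d N), ∑ i ∈ univ.filter (fun i => (supp i ∩ Y).Nonempty),
      Real.exp (-(δ / 2 * torusTreeLen (supp i))) * (supp i).card ≤ K * Y.card)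
    {m : ℕ} (hm : 1 ≤ m) (U : Finset (TPt d N)) (hU : U.Nonempty) :
    ∑ l ∈ (listsLen (S := ι) m).filter (fun l => List.IsChain (fun i j => ¬ Disjoint (supp i) (supp j)) l ∧ (l.map supp).foldr (· ∪ ·) ∅ = U), (l.map fun i => ‖T i‖).prod
      ≤ c ^ m * Real.exp (δ * (m - 1)) * Real.exp (-(δ / 2 * torusTreeLen U)) * (K ^ m * U.card) := by
  set CH := (listsLen (S := ι) m).filter (fun l => List.IsChain (fun i j => ¬ Disjoint (supp i) (supp j)) l ∧ (l.map supp).foldr (· ∪ ·) ∅ = U) with hCH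
  set v : ι → ℝ := fun i => Real.exp (-(δ / 2 * torusTreeLen (supp i))) with hv
  have hv0 : ∀ i, 0 ≤ v i := fun i => Real.exp_nonneg _
  have hne' : ∀ i, (supp i).Nonempty := fun i => (hsupp i).1
  -- termwise: ‖T‖-products ≤ (c e^{−δ d})-products ≤ cᵐ e^{δ(m−1)} e^{−(δ/2)d(U)} · v-products
  have hstep : ∀ l ∈ CH, (l.map fun i => ‖T i‖).prod ≤ c ^ m * Real.exp (δ * (m - 1)) * Real.exp (-(δ / 2 * torusTreeLen U)) * (l.map v).prod := by
    intro l hl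
    rw [hCH] at hl
    obtain ⟨hl, hch, hlU⟩ := mem_filter.1 hl
    have hlen : l.length = m := (mem_listsLen_iff m l).1 hl
    have hne : l ≠ [] := by rintro rfl; simp at hlen; omega
    have h1 := prod_map_le_of_le (fun i => ‖T i‖) (fun i => c * Real.exp (-(δ * torusTreeLen (supp i)))) (fun i => norm_nonneg _) hT l
    have h2 := prod_exp_decay_le supp hsupp hc hδ l hne hch
    rw [hlU, hlen] at h2
    exact h1.trans h2
  calc ∑ l ∈ CH, (l.map fun i => ‖T i‖).prod
      ≤ ∑ l ∈ CH, c ^ m * Real.exp (δ * (m - 1)) * Real.exp (-(δ / 2 * torusTreeLen U)) * (l.map v).prod := sum_le_sum hstep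
    _ = c ^ m * Real.exp (δ * (m - 1)) * Real.exp (-(δ / 2 * torusTreeLen U)) * ∑ l ∈ CH, (l.map v).prod := by rw [mul_sum]
    _ ≤ c ^ m * Real.exp (δ * (m - 1)) * Real.exp (-(δ / 2 * torusTreeLen U)) * (K ^ m * U.card) := by
        refine mul_le_mul_of_nonneg_left ?_ (by positivity)
        rw [hCH]
        exact (chainSumTo_le_anchored hv0 hne' m U).trans (anchoredChainSum_le hv0 hne' hK hcount m U hU)

/-- ★★★ **THE POWER MEMBER's PIECE OF `U` IN `LogHalfBound` SHAPE**: with PART A's deterministic bound, for `m ≥ 1` and a non-empty cube set `U`,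
`‖locPowPiece supp T m U‖ ≤ N_U · cᵐ e^{δ(m−1)} e^{−(δ∕2) d(U)} Kᵐ |U|`, `N_U = #{s : cube s ∈ U}` — summable against the (63) coefficients `R⁻ᵐ∕2m` as soon as `R > c·K·e^{δ}` (the glue's choice of the
radius). [cite: Balaban1985UV3, (63) p.272, (23) p.262; Balaban1988RG2Cluster, (2.27) p.18, (1.26) p.8; Balaban1987RG1, (1.18) p.263] -/
theorem norm_locPowPiece_le_decay (hsupp : ∀ i, IsTDom (supp i)) (hTsupp : ∀ i s s', (cube s ∉ supp i ∨ cube s' ∉ supp i) → T i s s' = 0)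
    {c δ K : ℝ} (hc : 0 ≤ c) (hδ : 0 ≤ δ) (hK : 0 ≤ K)
    (hT : ∀ i, ‖T i‖ ≤ c * Real.exp (-(δ * torusTreeLen (supp i))))
    (hcount : ∀ Y : Finset (TPt d N), ∑ i ∈ univ.filter (fun i => (supp i ∩ Y).Nonempty),
      Real.exp (-(δ / 2 * torusTreeLen (supp i))) * (supp i).card ≤ K * Y.card)
    {m : ℕ} (hm : 1 ≤ m) (U : Finset (TPt d N)) (hU : U.Nonempty) :
    ‖locPowPiece supp T m U‖ ≤ ((univ.filter fun s : S => cube s ∈ U).card : ℝ) *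
      (c ^ m * Real.exp (δ * (m - 1)) * Real.exp (-(δ / 2 * torusTreeLen U)) * (K ^ m * U.card)) :=
  (norm_locPowPiece_le (cube := cube) hTsupp hm U).trans (mul_le_mul_of_nonneg_left (chainSum_le hsupp hc hδ hK hT hcount hm U hU) (by positivity))

end Polymer

end Summit.QuantumFields.YangMills.Theorems.BalabanUVNodesPortS1
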